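import Summits.AtomisticToContinuum.BoseEinsteinCondensation.Theses.BECThomsonPrinciple
import HarnessLib

/-!
# Route `BECThomsonPrinciple`, glue item `GDCanOfFlows` (stmt-AtomisticToContinuum-14723):
# the logical skeleton of the glue

`GDCanOfFlows : FibreConductance → DensityResponse → GaussianDominationCan` is the route's flow-mechanism
synthesis filed as one support item. As a proposition it is a curried implication whose consequent is
the route's spine crux `GaussianDominationCan` (stmt-AtomisticToContinuum-9479), so it is settled by ANY
of three events, each by a one-line term recorded here so that the closing file is mechanical:

* `gdCanOfFlows_of_gaussianDominationCan` — the crux itself is proved (by whichever line);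
* `gdCanOfFlows_of_not_fibreConductance` — the fibre-flow crux (stmt-9480) is refuted (vacuity);
* `gdCanOfFlows_of_not_densityResponse` — the density-channel crux (stmt-9481) is refuted (vacuity);

and `gdCanOfFlows_iff_or` is the classical normal form
`GDCanOfFlows ↔ GaussianDominationCan ∨ ¬FibreConductance ∨ ¬DensityResponse`, i.e. a refutation
`¬GDCanOfFlows` would need BOTH mechanism cruxes true AND the spine crux false.

Nothing here touches the mathematics of the flow mechanism (Thomson duality for the `Λ_k`-charge over
`Ψ₀²`, fibre flows, bath flow); its abstract flux-side tools live in
`Literature.MathematicalPhysics.QuantumManyBody.WeightedThomsonPrinciple` (Thomson's principle and fibre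
subadditivity for the Kipnis–Varadhan `H₋₁` norm `hMinusOneSqW`).
-/

namespace Summit.AtomisticToContinuum.BoseEinsteinCondensation.Theorems

open Summit.AtomisticToContinuum.BoseEinsteinCondensation.Theses.BECThomsonPrinciple

/-- The glue follows from its consequent: once canonical Gaussian domination `GaussianDominationCan`
(stmt-AtomisticToContinuum-9479) is proved, `GDCanOfFlows` closes by discarding both hypotheses.
[folklore] -/
theorem gdCanOfFlows_of_gaussianDominationCan (h : GaussianDominationCan) : GDCanOfFlows :=
  fun _ _ => h

/-- Vacuity, first hypothesis: a refutation of `FibreConductance` (stmt-AtomisticToContinuum-9480)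
proves the glue. [folklore] -/
theorem gdCanOfFlows_of_not_fibreConductance (h : ¬ FibreConductance) : GDCanOfFlows :=
  fun hF _ => absurd hF h

/-- Vacuity, second hypothesis: a refutation of `DensityResponse` (stmt-AtomisticToContinuum-9481)
proves the glue. [folklore] -/
theorem gdCanOfFlows_of_not_densityResponse (h : ¬ DensityResponse) : GDCanOfFlows :=
  fun _ hD => absurd hD h

/-- Uncurried form: the glue says that the two mechanism cruxes together imply the spine crux.
[folklore] -/
theorem gdCanOfFlows_iff_and_imp :
    GDCanOfFlows ↔ (FibreConductance ∧ DensityResponse → GaussianDominationCan) :=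
  ⟨fun h hFD => h hFD.1 hFD.2, fun h hF hD => h ⟨hF, hD⟩⟩

/-- Classical normal form of the glue: `GDCanOfFlows` holds iff the spine crux holds or one of the
two mechanism cruxes fails. In particular `¬ GDCanOfFlows ↔ FibreConductance ∧ DensityResponse ∧
¬ GaussianDominationCan`. [folklore] -/
theorem gdCanOfFlows_iff_or :
    GDCanOfFlows ↔ (GaussianDominationCan ∨ ¬ FibreConductance ∨ ¬ DensityResponse) := by
  refine ⟨fun h => ?_, fun h hF hD => ?_⟩
  · by_cases hF : FibreConductance
    · by_cases hD : DensityResponse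
      · exact Or.inl (h hF hD)
      · exact Or.inr (Or.inr hD)
    · exact Or.inr (Or.inl hF)
  · rcases h with hG | hnF | hnD
    · exact hG
    · exact absurd hF hnF
    · exact absurd hD hnD

/-- What a refutation of the glue would have to exhibit: both mechanism cruxes and the failure of the
spine crux (superfluid-stiffness failure WITH good fibre conductance and compressibility). [folklore] -/
theorem not_gdCanOfFlows_iff :
    ¬ GDCanOfFlows ↔ (FibreConductance ∧ DensityResponse ∧ ¬ GaussianDominationCan) := by
  rw [gdCanOfFlows_iff_or]
  constructor
  · intro h
    exact ⟨Classical.byContradiction fun hF => h (Or.inr (Or.inl hF)),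
      Classical.byContradiction fun hD => h (Or.inr (Or.inr hD)), fun hG => h (Or.inl hG)⟩
  · rintro ⟨hF, hD, hG⟩ (h | h | h)
    · exact hG h
    · exact h hF
    · exact h hD

end Summit.AtomisticToContinuum.BoseEinsteinCondensation.Theorems
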